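import Literature.MathematicalPhysics.KineticTheory.Hilbert6ViscosityProofs
import Literature.MathematicalPhysics.KineticTheory.Hilbert6LinearizedBoltzmannGapProofs
import Literature.Analysis.UnboundedOperators.LinearizedBoltzmannBddAboveProofs
import Literature.Analysis.UnboundedOperators.LinearizedBoltzmannSymmetryProofs
import Literature.Analysis.UnboundedOperators.LinearizedBoltzmannSpectralGapProofs
import HarnessLib

/-!
# Positivity of the hard-sphere viscosity from the spectral gap alone

Sibling proof file of `Hilbert6LinearizedBoltzmann.lean` (topic
`Literature/MathematicalPhysics/KineticTheory`), completing `Hilbert6ViscosityProofs.lean`. The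
statement file vendors the named fact `hardSphereViscosity_pos` (strict positivity, in velocity
dimension `d ≥ 2`, of the Chapman–Enskog viscosity
`ν = (1 / ((d - 1) (d + 2))) ∑_{i,j} ⟪A_{ij}, (-L)⁻¹ A_{ij}⟫_M` of the hard-sphere gas, `L` the
linearised hard-sphere collision operator, `⟪A, (-L)⁻¹ A⟫_M` the variational pseudo-inverse form
`dirichletFormInv`). `Hilbert6ViscosityProofs` reduces it (`hardSphereViscosity_pos_of`) to the
prelude fact `dirichletFormInv_pos_of_orthogonal_of_ne_zero`; in the prelude's proof files that
fact is reduced to the symmetry of `L` and the spectral gap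
(`Literature.Analysis.UnboundedOperators.dirichletFormInv_pos_of_orthogonal_of_ne_zero_of_comm_of_gap`),
and the symmetry is discharged (`maxwellianInner_linearizedCollisionOp_comm_holds`).

## What is proved here

Assembling these, `hardSphereViscosity_pos` rests on exactly ONE undischarged named fact, the
hard-sphere spectral gap on `V d = ℝ^d`:

* `hardSphereViscosity_pos_of_gap (hZ) : hardSphereViscosity_pos`, with `hZ` the prelude fact
  `Literature.Analysis.UnboundedOperators.le_neg_maxwellianInner_hardSphereLinearizedOp_of_orthogonal`
  at `E = V d` (Baranger–Mouhot, Rev. Mat. Iberoam. 21 (2005) Thm 1.1, explicit; qualitatively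
  Grad 1963 and Cercignani–Illner–Pulvirenti 1994, Thm 7.2.5);
* `hardSphereViscosity_pos_of_spectralGap (h) : hardSphereViscosity_pos`, with `h` the
  statement-file form `hardSphereLinearizedOp_spectralGap` of the same gap (**hilbert6.S19**),
  which is the prelude fact at `E = V d` up to rewriting the hypothesis `2 ≤ finrank ℝ (V d)` as
  `2 ≤ d` (`finrank_euclideanSpace_fin`): within hilbert6.S19, positivity of the viscosity is a
  consequence of the spectral gap.

Once the gap is discharged, `hardSphereViscosity_pos_holds` is the one-liner
`hardSphereViscosity_pos_of_gap le_neg_maxwellianInner_hardSphereLinearizedOp_of_orthogonal_holds`.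
(The heat-conductivity analogue `hardSphereHeatConductivity_pos_of_gap` lives in
`Hilbert6HeatConductivityProofs`.)

## Discharge

The gap is now discharged in the tree
(`Literature.Analysis.UnboundedOperators.le_neg_maxwellianInner_hardSphereLinearizedOp_of_orthogonal_holds`,
file `LinearizedBoltzmannSpectralGapProofs`: fibre reduction to the one-dimensional coercivity,
the polynomial gap of the sphere-averaged rectangle form, density of polynomials in `L²(γ)`), so
the closed discharge `hardSphereViscosity_pos_holds : hardSphereViscosity_pos` is exactly that
one-liner; `hardSphereViscosity_pos` no longer rests on any undischarged named fact.

## Source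

Cercignani–Illner–Pulvirenti, *The Mathematical Theory of Dilute Gases* (Springer, Applied
Mathematical Sciences 106, 1994), §7.2: Theorem 7.2.1, p. 197 (`L` self-adjoint, non-positive,
null space = collision invariants) and Theorem 7.2.5, p. 201 (`0` is an isolated eigenvalue of
finite multiplicity, i.e. `-L` has a spectral gap on `(ker L)^⊥`), whence `(-L)⁻¹` is bounded and
positive definite on `(ker L)^⊥ ∋ A_{ij}`; §11.5, p. 333 ("the viscosity coefficient `ν > 0`").
This file adds nothing to the trust base: its only hypotheses are existing named facts.
-/

open Literature.Analysis.UnboundedOperators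

namespace Literature.MathematicalPhysics.KineticTheory

noncomputable section

variable {d : ℕ}

/-- **`hardSphereViscosity_pos` from the spectral gap.** Granted only the hard-sphere spectral-gap
fact `le_neg_maxwellianInner_hardSphereLinearizedOp_of_orthogonal` on `V d` (Baranger–Mouhot
2005 Thm 1.1; CIP 1994 Thm 7.2.5 p. 201), the viscosity is strictly positive in dimension
`d ≥ 2`: the positivity of the pseudo-inverse form follows from the gap and the discharged
symmetry of `L` (`dirichletFormInv_pos_of_orthogonal_of_ne_zero_of_comm_of_gap`,
`maxwellianInner_linearizedCollisionOp_comm_holds`), and `hardSphereViscosity_pos_of` concludes.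
[cite: CIPDiluteGases1994, §7.2 Thm 7.2.1 p. 197, Thm 7.2.5 p. 201; §11.5 p. 333] -/
theorem hardSphereViscosity_pos_of_gap
    (hZ : le_neg_maxwellianInner_hardSphereLinearizedOp_of_orthogonal (E := V d)) :
    hardSphereViscosity_pos (d := d) :=
  hardSphereViscosity_pos_of
    (dirichletFormInv_pos_of_orthogonal_of_ne_zero_of_comm_of_gap
      maxwellianInner_linearizedCollisionOp_comm_holds hZ)

/-- **Within hilbert6.S19, the spectral gap implies the positivity of the viscosity**: granted
the statement-file fact `hardSphereLinearizedOp_spectralGap` (the gap of `-L` on the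
`M`-orthogonal complement of the collision invariants in `L²(M dv)`, `d ≥ 2`), the hard-sphere
viscosity is strictly positive — convert to the prelude form of the gap (the same
statement, its hypothesis `2 ≤ finrank ℝ (V d)` being `2 ≤ d` by `finrank_euclideanSpace_fin`)
and apply `hardSphereViscosity_pos_of_gap` (CIP 1994 §7.2 Thm 7.2.5 p. 201 ⇒ §11.5 p. 333,
`ν > 0`).
[cite: CIPDiluteGases1994, §7.2 Thm 7.2.5 p. 201; §11.5 p. 333] -/
theorem hardSphereViscosity_pos_of_spectralGap (h : hardSphereLinearizedOp_spectralGap (d := d)) :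
    hardSphereViscosity_pos (d := d) :=
  hardSphereViscosity_pos_of_gap (d := d) fun hE => h (by simpa using hE)

/-- **Discharge of `hardSphereViscosity_pos`** (hilbert6.S19; CIP 1994 §7.2). In velocity
dimension `d ≥ 2` the Chapman–Enskog viscosity of the hard-sphere gas,
`ν = (1 / ((d - 1) (d + 2))) ∑_{i,j} ⟪A_{ij}, (-L)⁻¹ A_{ij}⟫_M` (`A_{ij}(v) = vᵢ vⱼ - δᵢⱼ |v|²/d` the
Burnett functions in the standard basis of `V d = ℝ^d`, `⟪A, (-L)⁻¹ A⟫_M = dirichletFormInv L A`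
the variational pseudo-inverse form), is strictly positive. Every input is proved in the tree:
the spectral gap of the linearised hard-sphere operator on the `M`-orthogonal complement of the
collision invariants (`le_neg_maxwellianInner_hardSphereLinearizedOp_of_orthogonal_holds`;
Grad 1963 §4 / Baranger–Mouhot 2005 Thm 1.1, qualitatively CIP 1994 §7.2 Thm 7.2.5, p. 201: `0`
is an isolated point of `σ(L)` whose eigenspace is the space of collision invariants, and
Thm 7.2.1, p. 197: `L` is self-adjoint and non-positive), fed to `hardSphereViscosity_pos_of_gap`
above (symmetry of `L`, CIP 1994 §7.1 (7.1.9), p. 192; the bound and the test function `g = ε A`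
of the variational family, `dirichletFormInv_pos_of_orthogonal_of_ne_zero_of_comm_of_gap`;
orthogonality of `A_{ij}` to the invariants, `burnettA_orthogonal_collisionInvariants_holds`;
`A_{01} ≠ 0` and the positivity of the normalising constant, `Hilbert6ViscosityProofs`). CIP 1994
§11.5, p. 333 records the conclusion ("the viscosity coefficient `ν > 0`").
[cite: CIPDiluteGases1994, §7.2 Thm 7.2.1 p. 197 and Thm 7.2.5 p. 201; §11.5 p. 333] -/
theorem hardSphereViscosity_pos_holds : hardSphereViscosity_pos (d := d) :=
  hardSphereViscosity_pos_of_gap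
    le_neg_maxwellianInner_hardSphereLinearizedOp_of_orthogonal_holds

end

end Literature.MathematicalPhysics.KineticTheory
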